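import Mathlib
import Summits.Ventures.PercRepro2.CrossAPrimeVMarkedLeaf

/-!
# A pendant root scales the v-marked vdB–Kahn statement
(blind cell PercRepro2, p5 g41; S4 §2.4 (s) addendum 59)

For the candidate `VMarkedVdBK p ends a₁ v o b` (CrossAPrimeVMarkedVdBK.lean) with the slack
`vSlack` of CrossAPrimeVMarkedLeaf.lean: if the ROOT `a₁` has exactly one edge `f = {a₁, w}`
(`a₁ ∉ {v, o, b, w}`), then `a₁ ↔ m ⟺ f open ∧ w ↔ m` for every `m ≠ a₁` (`conn_pendant_root_iff`),
the `w`-events are independent of `f` (`dependsOn_connEvent_pendant_root`), and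

  `vSlack(a₁) = p f·(1 − p f)·P(v, o, b ∈ C(w)) + (p f)²·vSlack(w)`   (`vMarked_slack_pendant_root`)

— so `VMarkedVdBK` at the neighbour `w` gives it at the pendant root `a₁`
(`vMarkedVdBK_of_pendant_root`).  With g40's leaf theorems (`vMarkedVdBK_of_leaf_v / _o / _b`) all
four marks of an open instance of (★₂′) may be taken of degree ≥ 2.  Tools: `OneEdge.conn_update_true_iff`,
`CrossAPrimeIsolatedFlip.conn_update_true_iff_of_isolated`, `eq_of_conn_of_isolated`, the
independence of events determined by disjoint edge sets (`prob_inter_eq_mul_of_dependsOn`).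
Own work; standard axioms.
-/

namespace Summit.Ventures.PercRepro2

open CrossAPrimeVMarked CrossAPrimeVMarkedCut CrossAPrimeVMarkedLeaf CrossAPrimeIsolatedFlip OneEdge

namespace CrossAPrimeVMarkedPendantRoot

variable {V : Type*} {E : Type*} [Fintype E] [DecidableEq E] [Fintype V] [DecidableEq V]
  {R : Type*} [Field R] [LinearOrder R] [IsStrictOrderedRing R]
variable {ends : E → Sym2 V}

section Conn

omit [Fintype E] [DecidableEq V] [Fintype V] in
/-- Closing the pendant edge `f` of `a₁` changes no connection among the other vertices. -/
lemma conn_update_false_iff_pendant {f : E} {a₁ w : V} (hf : ends f = s(a₁, w))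
    (ha : ∀ e, a₁ ∈ ends e → e = f) (ω : Config E) {x y : V} (hx : x ≠ a₁) (hy : y ≠ a₁) :
    Conn ends ω x y ↔ Conn ends (Function.update ω f false) x y := by
  have hf' : ends f = s(w, a₁) := by rw [hf, Sym2.eq_swap]
  have hiso : ∀ e, a₁ ∈ ends e → Function.update ω f false e = false := by
    intro e he
    rw [ha e he]
    simp
  by_cases hω : ω f = true
  · have hωeq : ω = Function.update (Function.update ω f false) f true := by
      rw [Function.update_idem, Function.update_eq_self_iff.2 hω.symm]
    conv_lhs => rw [hωeq]
    exact conn_update_true_iff_of_isolated hf' hiso hx hy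
  · simp only [Bool.not_eq_true] at hω
    rw [Function.update_eq_self_iff.2 hω.symm]

omit [Fintype E] [DecidableEq V] [Fintype V] in
/-- **At a pendant root**: `a₁ ↔ m` iff the pendant edge `f = {a₁, w}` is open and `w ↔ m`
(`m ≠ a₁`). -/
lemma conn_pendant_root_iff {f : E} {a₁ w : V} (hf : ends f = s(a₁, w))
    (ha : ∀ e, a₁ ∈ ends e → e = f) (hwa : w ≠ a₁) (ω : Config E) {m : V} (hm : m ≠ a₁) :
    Conn ends ω a₁ m ↔ ω f = true ∧ Conn ends ω w m := by
  have hf' : ends f = s(w, a₁) := by rw [hf, Sym2.eq_swap]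
  have hiso : ∀ e, a₁ ∈ ends e → Function.update ω f false e = false := by
    intro e he
    rw [ha e he]
    simp
  by_cases hω : ω f = true
  · have hωeq : ω = Function.update (Function.update ω f false) f true := by
      rw [Function.update_idem, Function.update_eq_self_iff.2 hω.symm]
    simp only [hω, true_and]
    rw [conn_update_false_iff_pendant hf ha ω hwa hm]
    conv_lhs => rw [hωeq]
    rw [conn_update_true_iff hf' _ a₁ m]
    constructor
    · rintro (h | ⟨-, h⟩ | ⟨-, h⟩)
      · exact absurd (eq_of_conn_of_isolated hiso h) hm
      · exact absurd (eq_of_conn_of_isolated hiso h) hm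
      · exact h
    · intro h
      exact Or.inr (Or.inr ⟨conn_refl ends _ a₁, h⟩)
  · simp only [Bool.not_eq_true] at hω
    have hiso' : ∀ e, a₁ ∈ ends e → ω e = false := by
      intro e he
      rw [ha e he]
      exact hω
    simp only [hω, Bool.false_eq_true, false_and, iff_false]
    intro h
    exact hm (eq_of_conn_of_isolated hiso' h)

omit [Fintype E] [DecidableEq V] [Fintype V] in
/-- The connection event `a₁ ↔ m` at a pendant root is `{f open} ∩ {w ↔ m}`. -/
lemma connEvent_pendant_root {f : E} {a₁ w : V} (hf : ends f = s(a₁, w))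
    (ha : ∀ e, a₁ ∈ ends e → e = f) (hwa : w ≠ a₁) {m : V} (hm : m ≠ a₁) :
    connEvent ends a₁ m = openEdge f ∩ connEvent ends w m := by
  ext ω
  simp only [mem_connEvent, Set.mem_inter_iff, mem_openEdge]
  exact conn_pendant_root_iff hf ha hwa ω hm

omit [Fintype E] [DecidableEq V] [Fintype V] in
/-- An event invariant under closing `f` is determined by the edges other than `f`. -/
lemma dependsOn_of_update_false {A : Set (Config E)} (f : E)
    (hA : ∀ ω, ω ∈ A ↔ Function.update ω f false ∈ A) :
    DependsOn (· ∈ A) ({f}ᶜ : Set E) := by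
  intro ω ω' h
  have hupd : Function.update ω f false = Function.update ω' f false := by
    funext e
    by_cases he : e = f
    · subst he
      simp
    · rw [Function.update_of_ne he, Function.update_of_ne he]
      exact h e (Set.mem_compl_singleton_iff.2 he)
  have h1 := hA ω
  have h2 := hA ω'
  rw [hupd] at h1
  exact propext (h1.trans h2.symm)

omit [Fintype E] [DecidableEq V] [Fintype V] in
/-- The `w`-connection events are determined by the edges other than the pendant edge `f`. -/
lemma dependsOn_connEvent_pendant_root {f : E} {a₁ w : V} (hf : ends f = s(a₁, w))
    (ha : ∀ e, a₁ ∈ ends e → e = f) (hwa : w ≠ a₁) {m : V} (hm : m ≠ a₁) :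
    DependsOn (· ∈ connEvent ends w m) ({f}ᶜ : Set E) :=
  dependsOn_of_update_false f fun ω => conn_update_false_iff_pendant hf ha ω hwa hm

end Conn

section Slack

omit [Fintype V] [DecidableEq V] [LinearOrder R] [IsStrictOrderedRing R] in
/-- `P({f open} ∩ X) = p f · P(X)` for an event `X` determined by the edges other than `f`. -/
lemma prob_openEdge_inter_of_dependsOn (p : E → R) (f : E) {X : Set (Config E)}
    (hX : DependsOn (· ∈ X) ({f}ᶜ : Set E)) : prob p (openEdge f ∩ X) = p f * prob p X := by
  rw [prob_inter_eq_mul_of_dependsOn p disjoint_compl_right (dependsOn_openEdge f) hX,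
    prob_openEdge]

omit [Fintype V] [LinearOrder R] [IsStrictOrderedRing R] in
/-- **A pendant root scales**: with `f = {a₁, w}` the only edge at `a₁` and `a₁ ∉ {v, o, b, w}`,
`vSlack(a₁) = p f·(1 − p f)·P(v, o, b ∈ C(w)) + (p f)²·vSlack(w)`. -/
theorem vMarked_slack_pendant_root (p : E → R) {f : E} {a₁ v o b w : V} (hf : ends f = s(a₁, w))
    (ha : ∀ e, a₁ ∈ ends e → e = f) (hva : v ≠ a₁) (hoa : o ≠ a₁) (hba : b ≠ a₁) (hwa : w ≠ a₁) :
    vSlack p ends a₁ v o b =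
      p f * (1 - p f) *
          prob p (connEvent ends w v ∩ connEvent ends w o ∩ connEvent ends w b) +
        p f ^ 2 * vSlack p ends w v o b := by
  have ev := connEvent_pendant_root hf ha hwa hva
  have eo := connEvent_pendant_root hf ha hwa hoa
  have eb := connEvent_pendant_root hf ha hwa hba
  have dv := dependsOn_connEvent_pendant_root hf ha hwa hva
  have dO := dependsOn_connEvent_pendant_root hf ha hwa hoa
  have dB := dependsOn_connEvent_pendant_root hf ha hwa hba
  unfold vSlack
  simp only [avoidAll_pair, avoidAll_singleton]
  rw [ev, eo, eb]
  set F := openEdge f with hF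
  set Dv := connEvent ends w v with hDv
  set Do := connEvent ends w o with hDo
  set Db := connEvent ends w b with hDb
  -- the `w`-events and their combinations are independent of `f`
  have dU : DependsOn (· ∈ Do ∪ Db) ({f}ᶜ : Set E) := by
    have := dependsOn_union dO dB
    rwa [Set.union_self] at this
  have d0 : DependsOn (· ∈ Doᶜ ∩ Dbᶜ ∩ Dv) ({f}ᶜ : Set E) := by
    have := dependsOn_inter (dependsOn_inter (dependsOn_compl dO) (dependsOn_compl dB)) dv
    rwa [Set.union_self, Set.union_self] at this
  have dnb : DependsOn (· ∈ Dbᶜ ∩ Dv) ({f}ᶜ : Set E) := by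
    have := dependsOn_inter (dependsOn_compl dB) dv
    rwa [Set.union_self] at this
  have dno : DependsOn (· ∈ Doᶜ ∩ Dv) ({f}ᶜ : Set E) := by
    have := dependsOn_inter (dependsOn_compl dO) dv
    rwa [Set.union_self] at this
  -- the seven masses at `a₁`
  have e1 : prob p (F ∩ Dv) = p f * prob p Dv := prob_openEdge_inter_of_dependsOn p f dv
  have e2 : prob p ((F ∩ Do)ᶜ ∩ (F ∩ Db)ᶜ) = 1 - p f * prob p (Do ∪ Db) := by
    rw [← Set.compl_union, prob_compl, ← Set.inter_union_distrib_left,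
      prob_openEdge_inter_of_dependsOn p f dU]
  have e3 : prob p ((F ∩ Do)ᶜ ∩ (F ∩ Db)ᶜ ∩ (F ∩ Dv)) = p f * prob p (Doᶜ ∩ Dbᶜ ∩ Dv) := by
    rw [← prob_openEdge_inter_of_dependsOn p f d0]
    congr 1
    ext ω; simp only [Set.mem_inter_iff, Set.mem_compl_iff]; tauto
  have e4 : prob p (F ∩ Do)ᶜ = 1 - p f * prob p Do := by
    rw [prob_compl, prob_openEdge_inter_of_dependsOn p f dO]
  have e5 : prob p ((F ∩ Db)ᶜ ∩ (F ∩ Dv)) = p f * prob p (Dbᶜ ∩ Dv) := by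
    rw [← prob_openEdge_inter_of_dependsOn p f dnb]
    congr 1
    ext ω; simp only [Set.mem_inter_iff, Set.mem_compl_iff]; tauto
  have e6 : prob p (F ∩ Db)ᶜ = 1 - p f * prob p Db := by
    rw [prob_compl, prob_openEdge_inter_of_dependsOn p f dB]
  have e7 : prob p ((F ∩ Do)ᶜ ∩ (F ∩ Dv)) = p f * prob p (Doᶜ ∩ Dv) := by
    rw [← prob_openEdge_inter_of_dependsOn p f dno]
    congr 1
    ext ω; simp only [Set.mem_inter_iff, Set.mem_compl_iff]; tauto
  -- the masses at `w`
  have w2 : prob p (Doᶜ ∩ Dbᶜ) = 1 - prob p (Do ∪ Db) := by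
    rw [← Set.compl_union, prob_compl]
  have w4 : prob p Doᶜ = 1 - prob p Do := prob_compl p Do
  have w6 : prob p Dbᶜ = 1 - prob p Db := prob_compl p Db
  -- inclusion–exclusion for `P(v, o, b ∈ C(w))`
  have i1 : prob p (Dv ∩ Do) + prob p (Dv ∩ Doᶜ) = prob p Dv := prob_inter_add_prob_inter_compl p Dv Do
  have i2 : prob p (Dv ∩ Do ∩ Db) + prob p (Dv ∩ Do ∩ Dbᶜ) = prob p (Dv ∩ Do) :=
    prob_inter_add_prob_inter_compl p (Dv ∩ Do) Db
  have i3 : prob p (Dv ∩ Dbᶜ ∩ Do) + prob p (Dv ∩ Dbᶜ ∩ Doᶜ) = prob p (Dv ∩ Dbᶜ) :=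
    prob_inter_add_prob_inter_compl p (Dv ∩ Dbᶜ) Do
  have s1 : Dv ∩ Dbᶜ ∩ Do = Dv ∩ Do ∩ Dbᶜ := by
    ext ω; simp only [Set.mem_inter_iff, Set.mem_compl_iff]; tauto
  have s2 : Dv ∩ Dbᶜ ∩ Doᶜ = Doᶜ ∩ Dbᶜ ∩ Dv := by
    ext ω; simp only [Set.mem_inter_iff, Set.mem_compl_iff]; tauto
  have s3 : Dv ∩ Dbᶜ = Dbᶜ ∩ Dv := Set.inter_comm _ _
  have s4 : Dv ∩ Doᶜ = Doᶜ ∩ Dv := Set.inter_comm _ _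
  rw [s1, s2, s3] at i3
  rw [s4] at i1
  rw [e1, e2, e3, e4, e5, e6, e7, w2, w4, w6]
  linear_combination (p f * (1 - p f)) * (i3 - i2 - i1)

omit [Fintype V] in
/-- `VMarkedVdBK` at the neighbour `w` of a pendant root `a₁` gives it at `a₁`. -/
theorem vMarkedVdBK_of_pendant_root {p : E → R} (hp : IsProbVec p) {f : E} {a₁ v o b w : V}
    (hf : ends f = s(a₁, w)) (ha : ∀ e, a₁ ∈ ends e → e = f) (hva : v ≠ a₁) (hoa : o ≠ a₁)
    (hba : b ≠ a₁) (hwa : w ≠ a₁) (h : VMarkedVdBK p ends w v o b) :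
    VMarkedVdBK p ends a₁ v o b := by
  rw [vMarkedVdBK_iff_vSlack] at h ⊢
  rw [vMarked_slack_pendant_root p hf ha hva hoa hba hwa]
  have h0 := hp.nonneg f
  have h1 := hp.le_one f
  have hP := prob_nonneg hp (connEvent ends w v ∩ connEvent ends w o ∩ connEvent ends w b)
  have := mul_nonneg (mul_nonneg h0 (sub_nonneg.2 h1)) hP
  nlinarith [sq_nonneg (p f)]

end Slack

end CrossAPrimeVMarkedPendantRoot

end Summit.Ventures.PercRepro2
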